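import Summits.CriticalPhenomena.PercolationContinuityZ3.Theorems.PercNearOneGluingNoHeavyLowerTailMajorityGluingQCertSymParts
import HarnessLib

/-!
# Part 17 of 18 of the orbit certificate of the cell `(12,7)` at `c = 157/100`: data and digest (lane prim-rate, constants-miner 1, gen 36; generated by cert/mksym.py)

Support file for the closed crux `NoHeavyLowerTail` (stmt-CriticalPhenomena-4575), majority-gluing line.  The symmetrised certificate of the cell `(12,7)`
(kit j286395, symcert.py) is checked IN PARTS (`…MajorityGluingQCertSymParts`): this file holds part 17 (1 multiplier terms, 1 marginal slacks,
0 rows, 0 squares; 3636 contributions) and its DIGEST `twelveSevenSymP17D` (43 orbit keys), verified by `decide +kernel` (`twelveSevenSymP17_digest`).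
The parts are glued in `…MajorityGluingQCertSymTwelveSeven`.  No sorries. [cite: VandenbergKahn2001, Thm 1.2 (p. 123)]
-/

namespace Summit.CriticalPhenomena.PercolationContinuityZ3.Theorems

namespace HubOnly
namespace QCert

/-- Row representatives of part 17: `(A, X, B, Y, n, masks of f(A,X), f(B,Y), f(A∪B,X∩Y), f(∅,X∪Y))`. -/
def twelveSevenSymP17Rows : List RowE :=
  []

/-- Square representatives of part 17: `(a, b, n, mask₁, mask₂)`. -/
def twelveSevenSymP17Sqs : List SqE :=
  []

/-- **Part 17** of the `(12,7)` orbit certificate at `157/100`. -/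
def twelveSevenSymP17 : SymCert :=
  ⟨⟨12, 7, 157, 100, 1, [], [], []⟩,
    [(4095, 33869252350218872)],
    [(0, 511, 52885385614450221056)],
    [twelveSevenSymP17Rows], [twelveSevenSymP17Sqs]⟩

/-- The digest of part 17: `(orbit key, coefficient total)` in increasing key order (computed by cert/mksym.py, verified below). -/
def twelveSevenSymP17D : List (ℕ × ℤ) :=
  [((4608 : ℕ), (52885385614450221056 : ℤ)), (12802, 423083084915601768448), (13312, 158656156843350663168), (29190, 1480790797204606189568), 
    (29698, 1269249254746805305344), (30720, 158656156843350663168), (61966, 2961581594409212379136), (62470, 4442372391613818568704), 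
    (63490, 1269249254746805305344), (65536, 52885385614450221056), (127518, 3701976993011515473920), (128014, 8884744783227637137408), 
    (129030, 4442372391613818568704), (131074, 423083084915601768448), (258622, 2961581594409212379136), (259102, 11105930979034546421760), 
    (260110, 8884744783227637137408), (262150, 1480790797204606189568), (520830, 1480790797204606189568), (521278, 8884744783227637137408), 
    (522270, 11105930979034546421760), (524302, 2961581594409212379136), (524414, -2682444786137334662400), (1045246, 423083084915601768448), 
    (1045630, 4442372391613818568704), (1046590, 8884744783227637137408), (1048606, 3701976993011515473920), (1048830, -1676527991335834164000), 
    (2094078, 52885385614450221056), (2094334, 1269249254746805305344), (2094590, 158656156843350663168), (2095230, 4442372391613818568704), 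
    (2095358, 1269249254746805305344), (2095614, 158656156843350663168), (2097214, 2961581594409212379136), (2097278, 1480790797204606189568), 
    (2097406, 423083084915601768448), (2097662, -692238166090364962944), (4195326, -223537065511444555200), (8390654, -40643102820262646400), 
    (16781310, -3386925235021887200), (16781823, -52885385614450221056), (16785407, 5317472618984362904)]

/-- **The digest of part 17 is `twelveSevenSymP17D`** (kernel evaluation of the part's 3636 contributions). -/
theorem twelveSevenSymP17_digest : twelveSevenSymP17.digest 20 = twelveSevenSymP17D := by
  decide +kernel

end QCert
end HubOnly

end Summit.CriticalPhenomena.PercolationContinuityZ3.Theorems
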